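import Mathlib
import Literature.Analysis.FluidPDE.Tao2016AveragedNS.ShiftSetCascadeFlows
import Literature.Analysis.FluidPDE.Tao2016AveragedNS.ShiftSetCascadeFlux
import Summits.NavierStokesRegularity.NavierStokesRegularity.Theorems.TaoLadderRungTwoFlatCertificateGlueTruncFlowOn
import Summits.NavierStokesRegularity.NavierStokesRegularity.Theorems.TaoLadderRungTwoFlatCertificateGlueFieldBoundsPerCompOn
import HarnessLib

/-!
# Certificate glue on a shift set `𝕊`, XVI-c: THE TRUNCATED WINDOW FIELD IN PER-COMPONENT WEIGHTED COORDINATES —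
  the bilinear form `PQc` / `PQcN`, its linearity, the (B)-bound from the table and the Lipschitz constant `2bR` on
  the weighted ball, for a weight table `ω : Fin m → ℤ → ℝ` (helper for items stmt-NavierStokesRegularity-22987
  `FlatGapCertificatesV2` (crux K_A♭ of route TaoLadderRungTwoFlat) and stmt-24295 K_A₂(64); cell harvest/h2-tao-ladder,
  p1 g15; theory-1 ruling R6a «per-component weights in wcoord/xcoord/InPara and hB ≤ b·ω i k»)

Glue XVI/XVII do this for one weight per SHELL. With per-component weights `x_{ic} = z i k_c / ω i k_c` (glue XIV-c's
`pwcoord` / `pwstate`) the truncated window field is again a bilinear form `PQc x y` on `Fin m × Fin W → ℝ`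
(`PQcN` on `Fin (m·W)`, S1's state space), and the abstract Lohner step of glue XVIII (`lohner_exists`, `lohner_land`,
sup-norm (B)-bound `|Q u v| ≤ b |u| |v|`) applies verbatim once

* `pqc_bound_of_table` — `Σ_{i₁,i₂,μ} |α i₁ i₂ i μ| (1+ε₀)^{5(k−μ₃)/2} ω̂_{i₁}(a) ω̂_{i₂}(b) ≤ b·ω i k` on the window
  ⇒ `|PQc x y|_c ≤ b·Nx·Ny` (the per-component (B)-table: a DIAGONAL SIMILARITY of the window coordinates, so only
  the weight PROFILE matters — bus l.494 (c));
* `pfieldLipOn_ball` — the same table bound ⇒ `PFieldLipOn ω (−Rω) (Rω) (2bR)` (glue XIV-c's Lipschitz input).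

HONEST FRAMING: Tao-type MODEL lattices (Tao 2016 §4/§6 vocabulary, shift-set parametrised); identities and
inequalities about an explicit polynomial field, nothing certified, no stub closed, nothing about the Navier–Stokes
equations.
-/

noncomputable section

-- the sub-problem namespace repeats the summit name by design (D-0017)
set_option linter.dupNamespace false

namespace Summit.NavierStokesRegularity.NavierStokesRegularity.Theorems

open Set Finset Literature.Analysis.FluidPDE Literature.Analysis.FluidPDE.TaoCascade

namespace CertificateGlueOn

variable {m : ℕ} {𝕊 : Finset (ℤ × ℤ × ℤ)} {ε₀ : ℝ} {α : Fin m → Fin m → Fin m → ℤ × ℤ × ℤ → ℝ} {Kb Ka : ℤ}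
  {ω : Fin m → ℤ → ℝ}

/-! ### Per-component weighted coordinates are linear -/

/-- `pwstate` is additive. [folklore] -/
theorem pwstate_add (x y : Fin m × Fin (winLen Kb Ka) → ℝ) :
    pwstate Kb Ka ω (x + y) = pwstate Kb Ka ω x + pwstate Kb Ka ω y := by
  funext i k
  simp only [pwstate, Pi.add_apply]
  split_ifs <;> ring

/-- `pwstate` is homogeneous. [folklore] -/
theorem pwstate_smul (r : ℝ) (x : Fin m × Fin (winLen Kb Ka) → ℝ) :
    pwstate Kb Ka ω (r • x) = r • pwstate Kb Ka ω x := by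
  funext i k
  simp only [pwstate, Pi.smul_apply, smul_eq_mul]
  split_ifs <;> ring

/-- `pwcoord` is additive. [folklore] -/
theorem pwcoord_add (Y Y' : Fin m → ℤ → ℝ) :
    pwcoord Kb Ka ω (Y + Y') = pwcoord Kb Ka ω Y + pwcoord Kb Ka ω Y' := by
  funext c; simp only [pwcoord, Pi.add_apply, add_div]

/-- `pwcoord` is homogeneous. [folklore] -/
theorem pwcoord_smul (r : ℝ) (Y : Fin m → ℤ → ℝ) :
    pwcoord Kb Ka ω (r • Y) = r • pwcoord Kb Ka ω Y := by
  funext c; simp only [pwcoord, Pi.smul_apply, smul_eq_mul, mul_div_assoc]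

/-- The truncated bilinear field IN PER-COMPONENT WEIGHTED WINDOW COORDINATES.
[cite: Tao2016AveragedNS, §4 (4.8); cell vocabulary, window-truncated] -/
def PQc (𝕊 : Finset (ℤ × ℤ × ℤ)) (ε₀ : ℝ) (α : Fin m → Fin m → Fin m → ℤ × ℤ × ℤ → ℝ) (Kb Ka : ℤ)
    (ω : Fin m → ℤ → ℝ) (x y : Fin m × Fin (winLen Kb Ka) → ℝ) : Fin m × Fin (winLen Kb Ka) → ℝ :=
  pwcoord Kb Ka ω (biFieldOn 𝕊 ε₀ α Kb Ka (pwstate Kb Ka ω x) (pwstate Kb Ka ω y))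

/-- `PQc` is linear in the second slot. [folklore] -/
theorem isLinearMap_PQc_right (x : Fin m × Fin (winLen Kb Ka) → ℝ) :
    IsLinearMap ℝ (PQc 𝕊 ε₀ α Kb Ka ω x) := by
  constructor
  · intro y y'; simp only [PQc, pwstate_add, biFieldOn_add_right, pwcoord_add]
  · intro r y; simp only [PQc, pwstate_smul, biFieldOn_smul_right, pwcoord_smul]

/-- `PQc` is linear in the first slot. [folklore] -/
theorem isLinearMap_PQc_left (y : Fin m × Fin (winLen Kb Ka) → ℝ) :
    IsLinearMap ℝ (fun x => PQc 𝕊 ε₀ α Kb Ka ω x y) := by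
  constructor
  · intro x x'; simp only [PQc, pwstate_add, biFieldOn_add_left, pwcoord_add]
  · intro r x; simp only [PQc, pwstate_smul, biFieldOn_smul_left, pwcoord_smul]

/-! ### The per-component (B)-bound from the table -/

/-- A truncated per-component weighted state is bounded by `N ω̂ i n`. [folklore] -/
theorem abs_truncAt_pwstate_le (hω : ∀ i k, 0 < ω i k) (hKK : 0 ≤ Ka + Kb + 1)
    {x : Fin m × Fin (winLen Kb Ka) → ℝ} {N : ℝ} (hx : ∀ c, |x c| ≤ N) (i : Fin m) (n : ℤ) :
    |truncAt Kb Ka (pwstate Kb Ka ω x) i n| ≤ N * pwExt Kb Ka ω i n := by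
  unfold truncAt pwExt
  split_ifs with hn
  · have hlt : (n + Kb).toNat < winLen Kb Ka := by
      unfold winLen; rw [Int.toNat_lt_toNat (by omega)]; omega
    set c : Fin (winLen Kb Ka) := ⟨(n + Kb).toNat, hlt⟩ with hc
    have hsh : shellAt Kb c = n := by
      simp only [shellAt, hc]; rw [Int.toNat_of_nonneg (by omega)]; ring
    have h1 := pwstate_on (ω := ω) x hKK i c
    rw [hsh] at h1
    rw [h1, abs_mul, abs_of_pos (hω i n), mul_comm]
    exact mul_le_mul_of_nonneg_right (hx (i, c)) (hω i n).le
  · simp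

/-- **THE PER-COMPONENT BILINEAR BOUND (B) FROM THE TABLE**: if
`Σ_{i₁,i₂,μ} |α i₁ i₂ i μ| (1+ε₀)^{5(k−μ₃)/2} ω̂_{i₁}(a) ω̂_{i₂}(b) ≤ b ω i k` on the window then `|PQc x y|_c ≤ b Nx Ny`
whenever `|x| ≤ Nx`, `|y| ≤ Ny` (unit S1-weights). [folklore] -/
theorem pqc_bound_of_table (hε : 0 < 1 + ε₀) (hω : ∀ i k, 0 < ω i k) (hKK : 0 ≤ Ka + Kb + 1) {b : ℝ}
    (htab : ∀ i k, -Kb ≤ k → k ≤ Ka →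
      ∑ i₁ : Fin m, ∑ i₂ : Fin m, ∑ μ ∈ 𝕊,
        |α i₁ i₂ i μ| * (1 + ε₀) ^ ((5 : ℝ) * (k - μ.2.2) / 2) *
          (pwExt Kb Ka ω i₁ (k - μ.2.2 + μ.1) * pwExt Kb Ka ω i₂ (k - μ.2.2 + μ.2.1)) ≤ b * ω i k) :
    ∀ (x y : Fin m × Fin (winLen Kb Ka) → ℝ) (Nx Ny : ℝ), 0 ≤ Nx → 0 ≤ Ny →
      (∀ c, |x c| ≤ Nx * (fun _ => (1 : ℝ)) c) → (∀ c, |y c| ≤ Ny * (fun _ => (1 : ℝ)) c) →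
        ∀ c, |PQc 𝕊 ε₀ α Kb Ka ω x y c| ≤ b * Nx * Ny * (fun _ => (1 : ℝ)) c := by
  intro x y Nx Ny hNx hNy hx hy c
  simp only [mul_one] at hx hy ⊢
  obtain ⟨h1, h2⟩ := shellAt_mem hKK c.2
  set k := shellAt Kb c.2 with hk
  unfold PQc pwcoord
  rw [abs_div, abs_of_pos (hω c.1 k), div_le_iff₀ (hω c.1 k)]
  unfold biFieldOn
  refine (Finset.abs_sum_le_sum_abs _ _).trans ?_
  have hgoal : ∑ i₁ : Fin m, |∑ i₂ : Fin m, ∑ μ ∈ 𝕊, α i₁ i₂ c.1 μ * (1 + ε₀) ^ ((5 : ℝ) * (k - μ.2.2) / 2) *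
        (truncAt Kb Ka (pwstate Kb Ka ω x) i₁ (k - μ.2.2 + μ.1) *
          truncAt Kb Ka (pwstate Kb Ka ω y) i₂ (k - μ.2.2 + μ.2.1))| ≤
      Nx * Ny * ∑ i₁ : Fin m, ∑ i₂ : Fin m, ∑ μ ∈ 𝕊,
        |α i₁ i₂ c.1 μ| * (1 + ε₀) ^ ((5 : ℝ) * (k - μ.2.2) / 2) *
          (pwExt Kb Ka ω i₁ (k - μ.2.2 + μ.1) * pwExt Kb Ka ω i₂ (k - μ.2.2 + μ.2.1)) := by
    rw [Finset.mul_sum]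
    refine Finset.sum_le_sum fun i₁ _ => ?_
    rw [Finset.mul_sum]
    refine (Finset.abs_sum_le_sum_abs _ _).trans (Finset.sum_le_sum fun i₂ _ => ?_)
    rw [Finset.mul_sum]
    refine (Finset.abs_sum_le_sum_abs _ _).trans (Finset.sum_le_sum fun μ _ => ?_)
    have hc0 : 0 ≤ (1 + ε₀) ^ ((5 : ℝ) * (k - μ.2.2) / 2) := (Real.rpow_pos_of_pos hε _).le
    have ha := abs_truncAt_pwstate_le hω hKK hx i₁ (k - μ.2.2 + μ.1)
    have hb := abs_truncAt_pwstate_le hω hKK hy i₂ (k - μ.2.2 + μ.2.1)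
    rw [abs_mul, abs_mul, abs_mul, abs_of_nonneg hc0]
    have hw1 : 0 ≤ pwExt Kb Ka ω i₁ (k - μ.2.2 + μ.1) := pwExt_nonneg (fun i k => (hω i k).le) _ _
    calc |α i₁ i₂ c.1 μ| * (1 + ε₀) ^ ((5 : ℝ) * (k - μ.2.2) / 2) *
          (|truncAt Kb Ka (pwstate Kb Ka ω x) i₁ (k - μ.2.2 + μ.1)| *
            |truncAt Kb Ka (pwstate Kb Ka ω y) i₂ (k - μ.2.2 + μ.2.1)|)
        ≤ |α i₁ i₂ c.1 μ| * (1 + ε₀) ^ ((5 : ℝ) * (k - μ.2.2) / 2) *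
          ((Nx * pwExt Kb Ka ω i₁ (k - μ.2.2 + μ.1)) * (Ny * pwExt Kb Ka ω i₂ (k - μ.2.2 + μ.2.1))) :=
          mul_le_mul_of_nonneg_left (mul_le_mul ha hb (abs_nonneg _) (mul_nonneg hNx hw1))
            (mul_nonneg (abs_nonneg _) hc0)
      _ = Nx * Ny * (|α i₁ i₂ c.1 μ| * (1 + ε₀) ^ ((5 : ℝ) * (k - μ.2.2) / 2) *
          (pwExt Kb Ka ω i₁ (k - μ.2.2 + μ.1) * pwExt Kb Ka ω i₂ (k - μ.2.2 + μ.2.1))) := by ring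
  refine hgoal.trans ?_
  calc Nx * Ny * _ ≤ Nx * Ny * (b * ω c.1 k) :=
        mul_le_mul_of_nonneg_left (htab c.1 k h1 h2) (mul_nonneg hNx hNy)
    _ = b * Nx * Ny * ω c.1 k := by ring

/-! ### Reindexing to `Fin n` -/

/-- The per-component bilinear field on `Fin (m·W) → ℝ` (S1's state space), through `finProdFinEquiv`. [folklore] -/
def PQcN (𝕊 : Finset (ℤ × ℤ × ℤ)) (ε₀ : ℝ) (α : Fin m → Fin m → Fin m → ℤ × ℤ × ℤ → ℝ) (Kb Ka : ℤ)
    (ω : Fin m → ℤ → ℝ) (x y : Fin (m * winLen Kb Ka) → ℝ) : Fin (m * winLen Kb Ka) → ℝ :=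
  fun d => PQc 𝕊 ε₀ α Kb Ka ω (x ∘ finProdFinEquiv) (y ∘ finProdFinEquiv) (finProdFinEquiv.symm d)

/-- `PQcN` is linear in the second slot. [folklore] -/
theorem isLinearMap_PQcN_right (x : Fin (m * winLen Kb Ka) → ℝ) :
    IsLinearMap ℝ (PQcN 𝕊 ε₀ α Kb Ka ω x) := by
  have hl := isLinearMap_PQc_right (𝕊 := 𝕊) (ε₀ := ε₀) (α := α) (Kb := Kb) (Ka := Ka) (ω := ω)
    (x ∘ finProdFinEquiv)
  constructor
  · intro y y'
    funext d
    have : (y + y') ∘ (finProdFinEquiv : Fin m × Fin (winLen Kb Ka) ≃ Fin (m * winLen Kb Ka)) =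
        y ∘ finProdFinEquiv + y' ∘ finProdFinEquiv := rfl
    simp only [PQcN, this, hl.map_add, Pi.add_apply]
  · intro r y
    funext d
    have : (r • y) ∘ (finProdFinEquiv : Fin m × Fin (winLen Kb Ka) ≃ Fin (m * winLen Kb Ka)) =
        r • (y ∘ finProdFinEquiv) := rfl
    simp only [PQcN, this, hl.map_smul, Pi.smul_apply]

/-- `PQcN` is linear in the first slot. [folklore] -/
theorem isLinearMap_PQcN_left (y : Fin (m * winLen Kb Ka) → ℝ) :
    IsLinearMap ℝ (fun x => PQcN 𝕊 ε₀ α Kb Ka ω x y) := by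
  have hl := isLinearMap_PQc_left (𝕊 := 𝕊) (ε₀ := ε₀) (α := α) (Kb := Kb) (Ka := Ka) (ω := ω)
    (y ∘ finProdFinEquiv)
  constructor
  · intro x x'
    funext d
    have : (x + x') ∘ (finProdFinEquiv : Fin m × Fin (winLen Kb Ka) ≃ Fin (m * winLen Kb Ka)) =
        x ∘ finProdFinEquiv + x' ∘ finProdFinEquiv := rfl
    simp only [PQcN, this, hl.map_add, Pi.add_apply]
  · intro r x
    funext d
    have : (r • x) ∘ (finProdFinEquiv : Fin m × Fin (winLen Kb Ka) ≃ Fin (m * winLen Kb Ka)) =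
        r • (x ∘ finProdFinEquiv) := rfl
    simp only [PQcN, this, hl.map_smul, Pi.smul_apply]

/-- **(B) in `Fin n` coordinates**: the table bound gives the sup-norm bilinear bound of `PQcN` consumed by glue XVIII.
[folklore] -/
theorem pqcN_bound_of_table (hε : 0 < 1 + ε₀) (hω : ∀ i k, 0 < ω i k) (hKK : 0 ≤ Ka + Kb + 1) {b : ℝ}
    (htab : ∀ i k, -Kb ≤ k → k ≤ Ka →
      ∑ i₁ : Fin m, ∑ i₂ : Fin m, ∑ μ ∈ 𝕊,
        |α i₁ i₂ i μ| * (1 + ε₀) ^ ((5 : ℝ) * (k - μ.2.2) / 2) *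
          (pwExt Kb Ka ω i₁ (k - μ.2.2 + μ.1) * pwExt Kb Ka ω i₂ (k - μ.2.2 + μ.2.1)) ≤ b * ω i k) :
    ∀ (u v : Fin (m * winLen Kb Ka) → ℝ) (Nu Nv : ℝ), 0 ≤ Nu → 0 ≤ Nv →
      (∀ c, |u c| ≤ Nu * (fun _ => (1 : ℝ)) c) → (∀ c, |v c| ≤ Nv * (fun _ => (1 : ℝ)) c) →
        ∀ c, |PQcN 𝕊 ε₀ α Kb Ka ω u v c| ≤ b * Nu * Nv * (fun _ => (1 : ℝ)) c := by
  intro u v Nu Nv hNu hNv hu hv d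
  have := pqc_bound_of_table (𝕊 := 𝕊) (ε₀ := ε₀) (α := α) hε hω hKK htab (u ∘ finProdFinEquiv)
    (v ∘ finProdFinEquiv) Nu Nv hNu hNv (fun c => hu (finProdFinEquiv c)) (fun c => hv (finProdFinEquiv c))
    (finProdFinEquiv.symm d)
  simpa [PQcN] using this

/-! ### The Lipschitz constant `2bR` on the weighted ball -/

/-- The box sup bound of the per-component weighted ball of radius `R` is `R ω̂ i n`. [folklore] -/
theorem boxSup_pball (hω : ∀ i k, 0 < ω i k) {R : ℝ} (hR : 0 ≤ R) (i : Fin m) (n : ℤ) :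
    boxSup Kb Ka (fun i k => -(R * ω i k)) (fun i k => R * ω i k) i n = R * pwExt Kb Ka ω i n := by
  unfold boxSup pwExt
  split_ifs with hn
  · have h0 : 0 ≤ R * ω i n := mul_nonneg hR (hω i n).le
    rw [abs_neg, abs_of_nonneg h0, max_self]
  · simp

/-- **Lipschitz constant `2bR` of the truncated field on the per-component weighted ball of radius `R`** from the
per-component (B)-table bound. [cite: MooreKearfottCloud2009, §6.2–6.4 (interval enclosures of ranges); cell certificate format, box layer] -/
theorem pfieldLipOn_ball (hε : 0 < 1 + ε₀) (hω : ∀ i k, 0 < ω i k) {b R : ℝ} (hR : 0 ≤ R)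
    (hB : ∀ i k, -Kb ≤ k → k ≤ Ka →
      ∑ i₁ : Fin m, ∑ i₂ : Fin m, ∑ μ ∈ 𝕊,
        |α i₁ i₂ i μ| * (1 + ε₀) ^ ((5 : ℝ) * (k - μ.2.2) / 2) *
          (pwExt Kb Ka ω i₁ (k - μ.2.2 + μ.1) * pwExt Kb Ka ω i₂ (k - μ.2.2 + μ.2.1)) ≤ b * ω i k) :
    PFieldLipOn 𝕊 ε₀ α Kb Ka ω (fun i k => -(R * ω i k)) (fun i k => R * ω i k) (2 * b * R) := by
  refine pfieldLipOn_of_table hε (fun i k => (hω i k).le) fun i k hk1 hk2 => ?_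
  have key : ∀ (i₁ i₂ : Fin m) (μ : ℤ × ℤ × ℤ),
      |α i₁ i₂ i μ| * (1 + ε₀) ^ ((5 : ℝ) * (k - μ.2.2) / 2) *
          (boxSup Kb Ka (fun i k => -(R * ω i k)) (fun i k => R * ω i k) i₁ (k - μ.2.2 + μ.1) *
              pwExt Kb Ka ω i₂ (k - μ.2.2 + μ.2.1) +
            pwExt Kb Ka ω i₁ (k - μ.2.2 + μ.1) *
              boxSup Kb Ka (fun i k => -(R * ω i k)) (fun i k => R * ω i k) i₂ (k - μ.2.2 + μ.2.1)) =
        2 * R * (|α i₁ i₂ i μ| * (1 + ε₀) ^ ((5 : ℝ) * (k - μ.2.2) / 2) *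
          (pwExt Kb Ka ω i₁ (k - μ.2.2 + μ.1) * pwExt Kb Ka ω i₂ (k - μ.2.2 + μ.2.1))) := by
    intro i₁ i₂ μ
    rw [boxSup_pball hω hR, boxSup_pball hω hR]
    ring
  calc _ = ∑ i₁ : Fin m, ∑ i₂ : Fin m, ∑ μ ∈ 𝕊, 2 * R * (|α i₁ i₂ i μ| * (1 + ε₀) ^ ((5 : ℝ) * (k - μ.2.2) / 2) *
          (pwExt Kb Ka ω i₁ (k - μ.2.2 + μ.1) * pwExt Kb Ka ω i₂ (k - μ.2.2 + μ.2.1))) :=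
        Finset.sum_congr rfl fun i₁ _ => Finset.sum_congr rfl fun i₂ _ => Finset.sum_congr rfl fun μ _ =>
          key i₁ i₂ μ
    _ = 2 * R * ∑ i₁ : Fin m, ∑ i₂ : Fin m, ∑ μ ∈ 𝕊, |α i₁ i₂ i μ| * (1 + ε₀) ^ ((5 : ℝ) * (k - μ.2.2) / 2) *
          (pwExt Kb Ka ω i₁ (k - μ.2.2 + μ.1) * pwExt Kb Ka ω i₂ (k - μ.2.2 + μ.2.1)) := by
        simp only [Finset.mul_sum]
    _ ≤ 2 * R * (b * ω i k) := mul_le_mul_of_nonneg_left (hB i k hk1 hk2) (by positivity)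
    _ = 2 * b * R * ω i k := by ring

end CertificateGlueOn

end Summit.NavierStokesRegularity.NavierStokesRegularity.Theorems

end
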